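import Mathlib
import Summits.NavierStokesRegularity.NavierStokesRegularity.Theorems.WakeRatchetTailRatchetScalarFrontPositive
import HarnessLib

/-!
# Scalar dyadic fronts (construction `DyadicScalarFronts`, stmt-NavierStokesRegularity-21808):
# RETENTION FLOOR modulo the action — `2Λ² − s² − s ≤ 4(Λ² − s²)·e^{A/Λ}`, hence
# `1 − μ ≥ (1 − Λ⁻¹)·e^{−A/Λ}/4` (no perfect conveyor, quantitatively)

Support file for the crux `WakeRatchet.TailRatchet` (stmt-21808; refuted BY NAME modulo the construction
`WakeRatchetDyadicFront.DyadicScalarFronts`, p589335; MODEL lattice ODEs of Tao 2016 §1.2, §4 — nothing here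
concerns the Navier–Stokes equations, and no item is closed).  The crux asked for a retention `1 − μ ≥ w`
UNIFORM in `ε₀`; the tree proves `μ = s²/Λ² < 1` for every non-trivial admissible front
(`WakeRatchetScalarFrontPositiveWake.dssMu_lt_one_of_front`, no perfect conveyor) without a rate.  This file
makes the wake side quantitative in terms of the ACTION `A = ∫_{t<0} a` (the per-shell admissibility constant of
the eternal solution the front carries):

* `flux_le_wake_energy` — by the wake fraction (`WakeRatchetScalarFrontPositive.wake_ge`: `a ≤ e^{A/Λ}·L`)
  the throughput is at most `∫ a²a(s·) ≤ e^{A/Λ}·L·∫a²`;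
* `retention_floor_action` — combining the wake–throughput identity `L² = 2(Λ/s − s/Λ)∫a²a(s·)` with the wake
  floor `L ≥ (2Λ² − s² − s)/(2sΛ)·∫a²` gives `2Λ² − s² − s ≤ 4(Λ² − s²)·e^{A/Λ}`;
* `one_sub_dssMu_ge` — hence `Λ² − s² ≥ Λ(Λ − 1)e^{−A/Λ}/4`, i.e. the per-shell energy ratio of the dictionary
  DSS wave obeys `1 − dssMu ε₀ (log s) ≥ (1 − Λ⁻¹)·e^{−A/Λ}/4`.

With `…ScalarFrontAction.no_slow_front_action` the hop ratio of every admissible front is confined to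
`[1 + c₁(Λ, A), (Λ² − Λ(Λ−1)e^{−A/Λ}/4)^{1/2}]`: both degenerate ends (`s → 1`, the logistic/no-pulse limit, and
`s → Λ`, the perfect conveyor) are excluded by the spread and the action alone (census G2/G3 of programme R-glob
modulo one size bound).

HONEST FRAMING: elementary real analysis about a MODEL lattice ODE; existence of fronts is NOT proved; an
a-priori action bound along the branch is NOT proved here; nothing about Navier–Stokes.
-/

noncomputable section

set_option linter.dupNamespace false

namespace Summit.NavierStokesRegularity.NavierStokesRegularity.Theorems

namespace WakeRatchetScalarFrontRetention

open Filter Topology Set MeasureTheory intervalIntegral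
open Literature.Analysis.FluidPDE Literature.Analysis.FluidPDE.TaoCascade
open WakeRatchetScalarFront WakeRatchetScalarFrontWake WakeRatchetScalarFrontPositiveWake
open WakeRatchetScalarFrontAdmissible WakeRatchetScalarFrontPositive

variable {ε₀ s : ℝ} {a : ℝ → ℝ}

/-- **Throughput ≤ wake × energy.**  For a profile of `DyadicScalarFronts` with wake limit `L`:
`∫_{t<0} a(t)² a(st) dt ≤ e^{A/Λ}·L·∫_{t<0} a²`, `A = ∫_{t<0} a`.
[cite: Tao2016AveragedNS, §1.2 (dyadic model, energy transfer `λⁿX_{n+1}X_n²`); elementary] -/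
theorem flux_le_wake_energy (hε : 0 < ε₀) (hs : 1 < s)
    (hode : ∀ t : ℝ, t < 0 → HasDerivAt a
      (bigLam ε₀ / s ^ 2 * a (t / s) ^ 2 - s / bigLam ε₀ * a t * a (s * t)) t)
    (hint : IntegrableOn a (Iio 0))
    (hbdd : ∃ t₀ : ℝ, t₀ < 0 ∧ ∃ P : ℝ, ∀ t : ℝ, t₀ ≤ t → t < 0 → |a t| ≤ P)
    {L : ℝ} (hL : Tendsto a (𝓝[<] 0) (𝓝 L)) :
    ∫ t in Iio 0, a t ^ 2 * a (s * t)
      ≤ Real.exp ((∫ v in Iio 0, a v) / bigLam ε₀) * L * ∫ t in Iio 0, a t ^ 2 := by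
  have hs0 : 0 < s := by linarith
  have hnn := nonneg_of_front hε hs hode hint hbdd
  have hcont := continuousOn_of_ode hode
  obtain ⟨P, hP⟩ := bounded hε hs hode hint hbdd
  have hsq : IntegrableOn (fun t => a t ^ 2) (Iio 0) := integrableOn_sq hcont hP hint
  have hq : IntegrableOn (fun t => a t ^ 2 * a (s * t)) (Iio 0) := integrableOn_flux hs0 hcont hP hint
  set E : ℝ := Real.exp ((∫ v in Iio 0, a v) / bigLam ε₀) with hE
  -- pointwise: `a(st) ≤ E·L`
  have hpt : ∀ t : ℝ, t < 0 → a (s * t) ≤ E * L := by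
    intro t ht
    have hst : s * t < 0 := mul_neg_of_pos_of_neg hs0 ht
    have h := wake_ge hε hs hode hint hnn hL hst
    -- h : a (s t) * exp(-(A/Λ)) ≤ L
    have hEpos : 0 < E := Real.exp_pos _
    have e : a (s * t) = (a (s * t) * Real.exp (-((∫ v in Iio 0, a v) / bigLam ε₀))) * E := by
      rw [hE, mul_assoc, ← Real.exp_add, neg_add_cancel, Real.exp_zero, mul_one]
    rw [e, mul_comm E L]
    exact mul_le_mul_of_nonneg_right h hEpos.le
  calc ∫ t in Iio 0, a t ^ 2 * a (s * t)
      ≤ ∫ t in Iio 0, a t ^ 2 * (E * L) := by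
        refine setIntegral_mono_on hq (hsq.mul_const _) measurableSet_Iio fun t ht => ?_
        exact mul_le_mul_of_nonneg_left (hpt t ht) (sq_nonneg _)
    _ = E * L * ∫ t in Iio 0, a t ^ 2 := by
        rw [MeasureTheory.integral_mul_const]; ring

/-- **Retention floor modulo the action.**  Every non-trivial profile of `DyadicScalarFronts` satisfies
`2Λ² − s² − s ≤ 4(Λ² − s²)·e^{A/Λ}`, `A = ∫_{t<0} a`.
[cite: Tao2016AveragedNS, §1.2, §4 (4.1); elementary] -/
theorem retention_floor_action (hε : 0 < ε₀) (hs : 1 < s)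
    (hode : ∀ t : ℝ, t < 0 → HasDerivAt a
      (bigLam ε₀ / s ^ 2 * a (t / s) ^ 2 - s / bigLam ε₀ * a t * a (s * t)) t)
    (hint : IntegrableOn a (Iio 0))
    (hbdd : ∃ t₀ : ℝ, t₀ < 0 ∧ ∃ P : ℝ, ∀ t : ℝ, t₀ ≤ t → t < 0 → |a t| ≤ P)
    (hne : ∃ t : ℝ, t < 0 ∧ a t ≠ 0) :
    2 * bigLam ε₀ ^ 2 - s ^ 2 - s
      ≤ 4 * (bigLam ε₀ ^ 2 - s ^ 2) * Real.exp ((∫ v in Iio 0, a v) / bigLam ε₀) := by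
  have hs0 : 0 < s := by linarith
  have hΛ : 0 < bigLam ε₀ := bigLam_pos (by linarith)
  have hcont := continuousOn_of_ode hode
  obtain ⟨P, hP⟩ := bounded hε hs hode hint hbdd
  have hbot := tendsto_atBot hε hs hode hint hbdd
  obtain ⟨L, hL, hLpos⟩ := wake_pos_of_front hε hs hode hint hbdd hne
  set E : ℝ := Real.exp ((∫ v in Iio 0, a v) / bigLam ε₀) with hE
  set I : ℝ := ∫ t in Iio 0, a t ^ 2 with hI
  set K : ℝ := ∫ t in Iio 0, a t ^ 2 * a (s * t) with hK
  have hIpos : 0 < I := sq_integral_pos hode (integrableOn_sq hcont hP hint) hne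
  have hEpos : 0 < E := Real.exp_pos _
  -- (1) wake floor: `c₁ I ≤ L`, c₁ = (2Λ² − s² − s)/(2sΛ)
  have hfloor := wake_lower_bound hε hs hode hP hint hbot hL
  -- (2) wake–throughput identity: `L² = 2(Λ/s − s/Λ) K`
  have hid := wake_identity hε hs hode hP hint hbot hL
  -- (3) throughput bound: `K ≤ E L I`
  have hflux := flux_le_wake_energy hε hs hode hint hbdd hL
  -- combine: L² ≤ 2(Λ/s − s/Λ) E L I, so L ≤ 2(Λ/s − s/Λ) E I (L > 0)
  have hcoef : 0 ≤ 2 * (bigLam ε₀ / s - s / bigLam ε₀) := by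
    have hsΛ : s ≤ bigLam ε₀ := le_bigLam_of_front hε hs hode hint hbdd hne
    have h1 : s / bigLam ε₀ ≤ 1 := (div_le_one hΛ).2 hsΛ
    have h2 : 1 ≤ bigLam ε₀ / s := (one_le_div hs0).2 hsΛ
    linarith
  have h1 : L ^ 2 ≤ 2 * (bigLam ε₀ / s - s / bigLam ε₀) * (E * L * I) := by
    rw [hid]; exact mul_le_mul_of_nonneg_left hflux hcoef
  have h2 : L ≤ 2 * (bigLam ε₀ / s - s / bigLam ε₀) * E * I := by
    have : L * L ≤ (2 * (bigLam ε₀ / s - s / bigLam ε₀) * E * I) * L := by nlinarith [h1]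
    exact le_of_mul_le_mul_right this hLpos
  -- with the floor: c₁ I ≤ 2(Λ/s − s/Λ) E I, divide by I > 0
  have h3 : (2 * bigLam ε₀ ^ 2 - s ^ 2 - s) / (2 * s * bigLam ε₀)
      ≤ 2 * (bigLam ε₀ / s - s / bigLam ε₀) * E :=
    le_of_mul_le_mul_right (hfloor.trans h2 |>.trans_eq (by ring)) hIpos
  -- clear denominators: multiply by `2sΛ > 0`
  have h4 := mul_le_mul_of_nonneg_right h3 (by positivity : (0:ℝ) ≤ 2 * s * bigLam ε₀)
  have e1 : (2 * bigLam ε₀ ^ 2 - s ^ 2 - s) / (2 * s * bigLam ε₀) * (2 * s * bigLam ε₀)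
      = 2 * bigLam ε₀ ^ 2 - s ^ 2 - s := by field_simp
  have e2 : 2 * (bigLam ε₀ / s - s / bigLam ε₀) * E * (2 * s * bigLam ε₀)
      = 4 * (bigLam ε₀ ^ 2 - s ^ 2) * E := by
    field_simp
    ring
  rw [e1, e2] at h4
  exact h4

/-- **Quantitative strict sub-unitarity.**  Every non-trivial profile of `DyadicScalarFronts` has
`Λ² − s² ≥ Λ(Λ − 1)·e^{−A/Λ}/4` and the per-shell energy ratio of its DSS wave obeys
`1 − dssMu ε₀ (log s) ≥ (1 − Λ⁻¹)·e^{−A/Λ}/4`, `A = ∫_{t<0} a`.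
[cite: Tao2016AveragedNS, §1.2, §4 (4.1); elementary] -/
theorem one_sub_dssMu_ge (hε : 0 < ε₀) (hs : 1 < s)
    (hode : ∀ t : ℝ, t < 0 → HasDerivAt a
      (bigLam ε₀ / s ^ 2 * a (t / s) ^ 2 - s / bigLam ε₀ * a t * a (s * t)) t)
    (hint : IntegrableOn a (Iio 0))
    (hbdd : ∃ t₀ : ℝ, t₀ < 0 ∧ ∃ P : ℝ, ∀ t : ℝ, t₀ ≤ t → t < 0 → |a t| ≤ P)
    (hne : ∃ t : ℝ, t < 0 ∧ a t ≠ 0) :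
    bigLam ε₀ * (bigLam ε₀ - 1) * Real.exp (-((∫ v in Iio 0, a v) / bigLam ε₀)) / 4
        ≤ bigLam ε₀ ^ 2 - s ^ 2 ∧
      (1 - (bigLam ε₀)⁻¹) * Real.exp (-((∫ v in Iio 0, a v) / bigLam ε₀)) / 4
        ≤ 1 - dssMu ε₀ (Real.log s) := by
  have hs0 : 0 < s := by linarith
  have hΛ : 0 < bigLam ε₀ := bigLam_pos (by linarith)
  have hsΛ : s ≤ bigLam ε₀ := le_bigLam_of_front hε hs hode hint hbdd hne
  have h := retention_floor_action hε hs hode hint hbdd hne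
  set E : ℝ := Real.exp ((∫ v in Iio 0, a v) / bigLam ε₀) with hE
  have hEpos : 0 < E := Real.exp_pos _
  have hEinv : Real.exp (-((∫ v in Iio 0, a v) / bigLam ε₀)) = E⁻¹ := by rw [Real.exp_neg]
  -- `Λ(Λ−1) ≤ 2Λ² − s² − s`
  have hlow : bigLam ε₀ * (bigLam ε₀ - 1) ≤ 2 * bigLam ε₀ ^ 2 - s ^ 2 - s := by nlinarith
  have hmain : bigLam ε₀ * (bigLam ε₀ - 1) * E⁻¹ / 4 ≤ bigLam ε₀ ^ 2 - s ^ 2 := by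
    have h1 : bigLam ε₀ * (bigLam ε₀ - 1) ≤ 4 * (bigLam ε₀ ^ 2 - s ^ 2) * E := hlow.trans h
    have h2 : bigLam ε₀ * (bigLam ε₀ - 1) * E⁻¹ ≤ 4 * (bigLam ε₀ ^ 2 - s ^ 2) := by
      have := mul_le_mul_of_nonneg_right h1 (inv_pos.2 hEpos).le
      rwa [mul_assoc (4 * (bigLam ε₀ ^ 2 - s ^ 2)), mul_inv_cancel₀ hEpos.ne', mul_one] at this
    linarith
  refine ⟨by rw [hEinv]; exact hmain, ?_⟩
  -- divide by `Λ²`: `1 − s²/Λ² ≥ (1 − Λ⁻¹) E⁻¹/4`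
  have hμ : dssMu ε₀ (Real.log s) = s ^ 2 / bigLam ε₀ ^ 2 := by
    unfold dssMu
    rw [show 2 * Real.log s = Real.log (s ^ 2) by rw [Real.log_pow]; norm_num,
      Real.exp_log (by positivity), ← bigLam_sq hε.le]
  rw [hEinv, hμ]
  have hΛ2 : 0 < bigLam ε₀ ^ 2 := by positivity
  have e1 : 1 - s ^ 2 / bigLam ε₀ ^ 2 = (bigLam ε₀ ^ 2 - s ^ 2) / bigLam ε₀ ^ 2 := by
    field_simp
  rw [e1, le_div_iff₀ hΛ2]
  have e : (1 - (bigLam ε₀)⁻¹) * E⁻¹ / 4 * bigLam ε₀ ^ 2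
      = bigLam ε₀ * (bigLam ε₀ - 1) * E⁻¹ / 4 := by
    field_simp
  rw [e]
  exact hmain

end WakeRatchetScalarFrontRetention

end Summit.NavierStokesRegularity.NavierStokesRegularity.Theorems

end
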